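import Summits.ValiantsHypothesis.ValiantsHypothesis.Theorems.BarrierLeverAnchoredDoorHitsLowerPairsGapOneStep
import Summits.ValiantsHypothesis.ValiantsHypothesis.Theorems.BarrierLeverAnchoredDoorHitsLowerPairsSwap

/-!
# Support item `AnchoredDoorHitsLowerPairs` (stmt-ValiantsHypothesis-22510), line `anchored-peeling`:
# THE GAP-ONE MOVE — the gap-one step as a strong-induction move on injective simplicial pairs (both sides)

Helper file (`--supports stmt-ValiantsHypothesis-22510`; cell valiant-natproofs, rung V4, 𝒟-side door (c); registered line
`Cruxes/AnchoredDoorHitsLowerPairs/Lines/anchored_peeling.lean` v13; prover seat val-np-p1 gen 19). Definition-free. Closes NO item.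

* `symbolicDet_ne_zero_of_gapOne_lower` — for an injective LOWER pair `(u, w)` and vertices `a` (x-side), `c` (y-side) with
  `#{i : a ∉ u i} = #{j : c ∉ w j} + 1` (link gap one: `ℓ_c = ℓ_a + 1`): if every injective lower pair with FEWER rows has a nonzero symbolic minor (the
  skeleton's strong induction hypothesis), then `symbolicDet s h r u w ≠ 0`. The dropped deletion row / link column are chosen ⊆-maximal, so the two reduced
  pairs of `symbolicDet_ne_zero_of_gapOne'` are lower.
* `symbolicDet_ne_zero_of_gapOne_lower_swap` — the same move on the `y`-side (`symbolicDet_ne_zero_comm`).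
Together with the star step (gap 0, `…StarStep`) this removes from any residual class every pair having a vertex pair `(a, c)` with `|ℓ_a − ℓ_c| ≤ 1` on
either side.

WHAT THIS IS NOT: not the registered stub `Stmt.stub_uqFaceStep`; nothing on crux stmt-ValiantsHypothesis-14610 or on `VP` versus `VNP`.
-/

set_option linter.dupNamespace false

namespace Summit.ValiantsHypothesis.ValiantsHypothesis.Theorems.BarrierLever.AnchoredPeeling

open Finset

noncomputable section

variable {s h r : ℕ} {u w : Fin r → Finset (Fin h)} {a c : Fin h}

/-- In a nonempty finite family of finsets (indexed by a subtype) some member is ⊆-maximal (a member of maximal cardinality). -/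
private theorem exists_subset_maximal {ι : Type*} [Fintype ι] (v : ι → Finset (Fin h)) (P : ι → Prop) [DecidablePred P]
    (hne : ∃ i, P i) : ∃ i₀, P i₀ ∧ ∀ i, P i → v i₀ ⊆ v i → v i = v i₀ := by
  classical
  have hne' : (Finset.univ.filter P).Nonempty := by
    obtain ⟨i, hi⟩ := hne
    exact ⟨i, Finset.mem_filter.mpr ⟨Finset.mem_univ _, hi⟩⟩
  obtain ⟨i₀, hi₀, hmax⟩ := Finset.exists_max_image (Finset.univ.filter P) (fun i => (v i).card) hne'
  refine ⟨i₀, (Finset.mem_filter.mp hi₀).2, fun i hi hsub => ?_⟩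
  exact (Finset.eq_of_subset_of_card_le hsub (hmax i (Finset.mem_filter.mpr ⟨Finset.mem_univ _, hi⟩))).symm

/-- **THE GAP-ONE MOVE (x-side).** -/
theorem symbolicDet_ne_zero_of_gapOne_lower (hs : 1 ≤ s) (hu : Function.Injective u) (hw : Function.Injective w)
    (hlu : IsLowerSet (Set.range u)) (hlw : IsLowerSet (Set.range w))
    (hgap : Fintype.card {i : Fin r // ¬ (a ∈ u i)} = Fintype.card {j : Fin r // c ∉ w j} + 1)
    (IH : ∀ r' < r, ∀ (u' w' : Fin r' → Finset (Fin h)), Function.Injective u' → Function.Injective w' →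
      IsLowerSet (Set.range u') → IsLowerSet (Set.range w') → symbolicDet s h r' u' w' ≠ 0) :
    symbolicDet s h r u w ≠ 0 := by
  classical
  -- cardinal bookkeeping
  have hcardC : Fintype.card {j : Fin r // ¬ (c ∉ w j)} = Fintype.card {i : Fin r // a ∈ u i} + 1 := by
    have h1 := Fintype.card_subtype_compl (fun i : Fin r => a ∈ u i)
    have h2 := Fintype.card_subtype_compl (fun j : Fin r => c ∉ w j)
    have h3 : Fintype.card {j : Fin r // c ∉ w j} ≤ Fintype.card (Fin r) := Fintype.card_subtype_le _
    have h4 : Fintype.card {i : Fin r // a ∈ u i} ≤ Fintype.card (Fin r) := Fintype.card_subtype_le _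
    omega
  -- a ⊆-maximal deletion row and a ⊆-maximal column through c
  have hdel_ne : ∃ i, a ∉ u i := by
    by_contra hno
    push Not at hno
    have : Fintype.card {i : Fin r // ¬ (a ∈ u i)} = 0 := Fintype.card_eq_zero_iff.mpr ⟨fun x => (x.2 (hno x.1)).elim⟩
    omega
  have hstar_ne : ∃ j, c ∈ w j := by
    by_contra hno
    push Not at hno
    have : Fintype.card {j : Fin r // ¬ (c ∉ w j)} = 0 := Fintype.card_eq_zero_iff.mpr ⟨fun x => (x.2 (hno x.1)).elim⟩
    omega
  obtain ⟨i₀, hi₀, hi₀max⟩ := exists_subset_maximal u (fun i => a ∉ u i) hdel_ne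
  obtain ⟨j₀, hj₀, hj₀max⟩ := exists_subset_maximal w (fun j => c ∈ w j) hstar_ne
  -- the column family contains ∅
  have hw0 : ∃ j, w j = ∅ := by
    obtain ⟨j, -⟩ := hstar_ne
    obtain ⟨j', hj'⟩ := hlw (Finset.empty_subset (w j)) ⟨j, rfl⟩
    exact ⟨j', hj'⟩
  refine symbolicDet_ne_zero_of_gapOne' hs hu hw hw0 hgap i₀ hi₀ ?_ j₀ hj₀ ?_
  · -- reduced deletion pair: lower, fewer rows
    intro r₁ u₁ w₁ hu₁ hw₁ hru hrw
    have hmem : ∀ k, ∃ i, u i = u₁ k := fun k => by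
      have : u₁ k ∈ Set.range u₁ := ⟨k, rfl⟩
      rw [hru] at this
      exact this.1
    choose g hg using hmem
    have hg_inj : Function.Injective g := fun k k' hkk => hu₁ (by rw [← hg k, ← hg k', hkk])
    have hg_ns : ¬ Function.Surjective g := by
      intro hsurj
      obtain ⟨k, hk⟩ := hsurj i₀
      have : u₁ k ∈ Set.range u₁ := ⟨k, rfl⟩
      rw [hru] at this
      exact this.2.2 (by rw [← hg k, hk])
    have hlt : r₁ < r := by
      have := Fintype.card_lt_of_injective_not_surjective g hg_inj hg_ns
      simpa using this
    refine IH r₁ hlt u₁ w₁ hu₁ hw₁ ?_ ?_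
    · intro S S' hS'S hS
      rw [hru] at hS ⊢
      obtain ⟨⟨i, rfl⟩, hai, hne⟩ := hS
      refine ⟨hlu hS'S ⟨i, rfl⟩, fun ha => hai (hS'S ha), fun hS' => ?_⟩
      -- S' = u i₀ ⊆ u i with a ∉ u i forces u i = u i₀
      exact hne (hi₀max i hai (hS' ▸ hS'S))
    · intro T T' hT'T hT
      rw [hrw] at hT ⊢
      obtain ⟨hT, hcT⟩ := hT
      exact ⟨hlw hT'T hT, fun hc => hcT (hT'T hc)⟩
  · -- reduced link pair: lower, fewer rows
    intro r₂ u₂ w₂ hu₂ hw₂ hru hrw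
    have hmem : ∀ k, ∃ i, u i = insert a (u₂ k) := fun k => by
      have : u₂ k ∈ Set.range u₂ := ⟨k, rfl⟩
      rw [hru] at this
      obtain ⟨i, hi⟩ := this.2
      exact ⟨i, hi⟩
    choose g hg using hmem
    have hnot : ∀ k, a ∉ u₂ k := fun k => by
      have : u₂ k ∈ Set.range u₂ := ⟨k, rfl⟩
      rw [hru] at this
      exact this.1
    have hg_inj : Function.Injective g := fun k k' hkk => hu₂ (by
      have := hg k
      rw [hkk, hg k'] at this
      rw [← Finset.erase_insert (hnot k), ← Finset.erase_insert (hnot k'), this])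
    have hg_ns : ¬ Function.Surjective g := by
      intro hsurj
      obtain ⟨k, hk⟩ := hsurj i₀
      exact hi₀ (by rw [← hk, hg k]; exact Finset.mem_insert_self a _)
    have hlt : r₂ < r := by
      have := Fintype.card_lt_of_injective_not_surjective g hg_inj hg_ns
      simpa using this
    refine IH r₂ hlt u₂ w₂ hu₂ hw₂ ?_ ?_
    · intro S S' hS'S hS
      rw [hru] at hS ⊢
      obtain ⟨haS, ⟨i, hi⟩⟩ := hS
      refine ⟨fun ha => haS (hS'S ha), ?_⟩
      exact hlu (Finset.insert_subset_insert a hS'S) ⟨i, hi⟩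
    · intro T T' hT'T hT
      rw [hrw] at hT ⊢
      obtain ⟨hcT, ⟨j, hj⟩, hne⟩ := hT
      refine ⟨fun hc => hcT (hT'T hc), hlw (Finset.insert_subset_insert c hT'T) ⟨j, hj⟩, fun hT' => ?_⟩
      -- insert c T' = w j₀ ⊆ insert c T = w j with c ∈ w j forces w j = w j₀
      have hcj : c ∈ w j := by rw [hj]; exact Finset.mem_insert_self c T
      have hsub : w j₀ ⊆ w j := by rw [← hT', hj]; exact Finset.insert_subset_insert c hT'T
      exact hne (by rw [← hj, hj₀max j hcj hsub])

/-- **THE GAP-ONE MOVE (y-side).** The same with the roles of the two complexes exchanged: vertices `c` (y-side) peeled onto `a` (x-side) with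
`#{j : c ∉ w j} = #{i : a ∉ u i} + 1`. -/
theorem symbolicDet_ne_zero_of_gapOne_lower_swap (hs : 1 ≤ s) (hu : Function.Injective u) (hw : Function.Injective w)
    (hlu : IsLowerSet (Set.range u)) (hlw : IsLowerSet (Set.range w))
    (hgap : Fintype.card {j : Fin r // ¬ (c ∈ w j)} = Fintype.card {i : Fin r // a ∉ u i} + 1)
    (IH : ∀ r' < r, ∀ (u' w' : Fin r' → Finset (Fin h)), Function.Injective u' → Function.Injective w' →
      IsLowerSet (Set.range u') → IsLowerSet (Set.range w') → symbolicDet s h r' u' w' ≠ 0) :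
    symbolicDet s h r u w ≠ 0 := by
  rw [symbolicDet_ne_zero_comm]
  exact symbolicDet_ne_zero_of_gapOne_lower hs hw hu hlw hlu hgap
    (fun r' hr' u' w' hu' hw' hlu' hlw' => (symbolicDet_ne_zero_comm s h r' w' u').mp (IH r' hr' w' u' hw' hu' hlw' hlu'))

end

end Summit.ValiantsHypothesis.ValiantsHypothesis.Theorems.BarrierLever.AnchoredPeeling
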